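/-
Origin: expansion seat `planner-pub-hodgecm-pv14-g6-0`, handover import Pv14g6.SchwartzTranslationDeriv -> import HodgeCM.Automorphic.SchwartzTranslationDeriv ; after SchwartzTranslationDeriv (this seat row 9, same run) (`HOME/pub-hodgecm-pv14-g6/lean/Pv14g6/SchrodingerInfinitesimal.lean`, md5 2800b937, 176 lines);
landed by the gen-8 packager in gate run 30 as `HodgeCM/Automorphic/SchrodingerInfinitesimal.lean` (import ^import Pv14g6\.SchwartzTranslationDeriv[ \t]*$→import HodgeCM.Automorphic.SchwartzTranslationDeriv ×1).
-/
/-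
Copyright (c) 2026. All rights reserved.
Released under Apache 2.0 license as described in the file LICENSE.
Origin: pub-hodgecm-pv14-g6 (DAG-node prover #14, gen 6), file #12; target
`HodgeCM/Automorphic/SchrodingerInfinitesimal.lean` (namespace `HodgeCM.SchwartzWeil`).  NEW ADDITIVE LEAF.
-/
import Summits.HodgeConjecture.HodgeCM.Automorphic.SchwartzTranslationDeriv

/-!
# The infinitesimal Schrödinger representation on Schwartz space

The one-parameter subgroups of the Heisenberg group `Heis V` (multiplication
`(a,b,u)(a',b',u') = (a+a', b+b', u u' 𝐞(-⟪a,b'⟫))`) are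
`γ_{a,b,c}(s) = (s a, s b, 𝐞(s c - s² ⟪a,b⟫ / 2))` (`Heis.expCurve`, `Heis.expCurve_add`).  We prove that the
weight-`m` Schrödinger representation `ρ_m` (`HodgeCM.SchwartzWeil.repCLM`) is differentiable at the identity
along EVERY such subgroup on EVERY Schwartz vector, IN THE SCHWARTZ TOPOLOGY, with the expected generator:

* `tendsto_repCLM_expCurve_sub_div` :
  `s⁻¹ • (ρ_m(γ_{a,b,c}(s)) Φ - Φ) ⟶ -∂_{a} Φ + (2πi m ⟪b, ·⟫) Φ + (2πi m c) • Φ` as `s → 0`, `s ≠ 0`;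
* `hasDerivAt_repCLM_expCurve` : the vector-valued form through any continuous `ℝ`-linear map.

So `dρ_m(a, b, c) = -∂_{a} + 2πi m ⟪b, x⟫ + 2πi m c` on the smooth domain `𝓢(V, ℂ)`.  Proof: the translation
and modulation cases (`SchwartzTranslationDeriv`, `SchwartzMultiplierDeriv`) combined through the JOINT
continuity of `(b, Φ) ↦ M_b Φ` (`continuous_modCLM_uncurry`) and a scalar phase.

Not here: higher derivatives / the Weyl-algebra action, essential skew-adjointness, integration back to `ρ_m`.
-/

noncomputable section

open scoped Real FourierTransform SchwartzMap RealInnerProductSpace Topology LineDeriv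
open Complex Filter

namespace HodgeCM
namespace SchwartzWeil

variable {V : Type} [NormedAddCommGroup V] [InnerProductSpace ℝ V]

namespace Heis

/-- The one-parameter subgroup of `Heis V` with tangent `(a, b, c)` at the identity. -/
def expCurve (a b : V) (c : ℝ) (s : ℝ) : Heis V := ⟨s • a, s • b, 𝐞 (s * c - s ^ 2 * ⟪a, b⟫ / 2)⟩

/-- (Ported verbatim from the HodgeCMPerL package; no docstring in the source.) -/
@[simp] theorem expCurve_a (a b : V) (c s : ℝ) : (expCurve a b c s).a = s • a := rfl
/-- (Ported verbatim from the HodgeCMPerL package; no docstring in the source.) -/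
@[simp] theorem expCurve_b (a b : V) (c s : ℝ) : (expCurve a b c s).b = s • b := rfl
/-- (Ported verbatim from the HodgeCMPerL package; no docstring in the source.) -/
@[simp] theorem expCurve_u (a b : V) (c s : ℝ) :
    (expCurve a b c s).u = 𝐞 (s * c - s ^ 2 * ⟪a, b⟫ / 2) := rfl

/-- (Ported verbatim from the HodgeCMPerL package; no docstring in the source.) -/
theorem expCurve_zero (a b : V) (c : ℝ) : expCurve a b c 0 = 1 := by
  ext <;> simp

/-- `γ_{a,b,c}` is a one-parameter subgroup. -/
theorem expCurve_add (a b : V) (c s t : ℝ) : expCurve a b c (s + t) = expCurve a b c s * expCurve a b c t := by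
  ext : 1
  · simp [add_smul]
  · simp [add_smul]
  · simp only [expCurve_u, mul_u, expCurve_a, expCurve_b, real_inner_smul_left, real_inner_smul_right,
      ← AddChar.map_add_eq_mul]
    exact congrArg (fun r : ℝ => (𝐞 r : Circle)) (by ring)

/-- The central phase of `γ_{a,b,c}(s)` in weight `m`. -/
theorem coe_expCurve_u_zpow (m : ℤ) (a b : V) (c s : ℝ) :
    ((expCurve a b c s).u : ℂ) ^ m = 𝐞 ((m : ℝ) * (s * c - s ^ 2 * ⟪a, b⟫ / 2)) := by
  rw [expCurve_u, ← Circle.coe_zpow, ← AddChar.map_zsmul_eq_zpow, zsmul_eq_mul]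

end Heis

/-! ## The scalar phase -/

section Phase

variable (μ c q : ℝ)

/-- (Ported verbatim from the HodgeCMPerL package; no docstring in the source.) -/
theorem hasDerivAt_phase : HasDerivAt (fun s : ℝ => μ * (s * c - s ^ 2 * q / 2)) (μ * c) 0 := by
  have h := (((hasDerivAt_id' (0 : ℝ)).mul_const c).sub
    (((hasDerivAt_pow 2 (0 : ℝ)).mul_const q).div_const 2)).const_mul μ
  refine h.congr_deriv ?_
  simp

/-- (Ported verbatim from the HodgeCMPerL package; no docstring in the source.) -/
theorem hasDerivAt_fourierChar_phase :
    HasDerivAt (fun s : ℝ => (𝐞 (μ * (s * c - s ^ 2 * q / 2)) : ℂ)) (2 * π * I * (μ * c)) 0 := by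
  have h := (Real.hasDerivAt_fourierChar (μ * (0 * c - 0 ^ 2 * q / 2))).scomp (0 : ℝ)
    (hasDerivAt_phase μ c q)
  refine h.congr_deriv ?_
  rw [Complex.real_smul]
  simp only [zero_mul, ne_eq, OfNat.ofNat_ne_zero, not_false_eq_true, zero_pow, zero_div, sub_zero,
    mul_zero, AddChar.map_zero_eq_one, Circle.coe_one, mul_one]
  push_cast
  ring

/-- (Ported verbatim from the HodgeCMPerL package; no docstring in the source.) -/
theorem tendsto_fourierChar_phase_sub_div :
    Tendsto (fun s : ℝ => s⁻¹ • ((𝐞 (μ * (s * c - s ^ 2 * q / 2)) : ℂ) - 1)) (𝓝[≠] 0)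
      (𝓝 (2 * π * I * (μ * c))) := by
  have h := hasDerivAt_iff_tendsto_slope_zero.mp (hasDerivAt_fourierChar_phase μ c q)
  simpa using h

/-- (Ported verbatim from the HodgeCMPerL package; no docstring in the source.) -/
theorem tendsto_fourierChar_phase :
    Tendsto (fun s : ℝ => (𝐞 (μ * (s * c - s ^ 2 * q / 2)) : ℂ)) (𝓝[≠] 0) (𝓝 1) := by
  have h := (hasDerivAt_fourierChar_phase μ c q).continuousAt.tendsto
  simp only [zero_mul, ne_eq, OfNat.ofNat_ne_zero, not_false_eq_true, zero_pow, zero_div, sub_zero,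
    mul_zero, AddChar.map_zero_eq_one, Circle.coe_one] at h
  exact h.mono_left nhdsWithin_le_nhds

end Phase

/-! ## The derivative of `ρ_m` along `γ_{a,b,c}` -/

variable (V) [FiniteDimensional ℝ V] [MeasurableSpace V] [BorelSpace V] (m : ℤ)

/-- (Ported verbatim from the HodgeCMPerL package; no docstring in the source.) -/
theorem repCLM_expCurve_apply (a b : V) (c s : ℝ) (Φ : 𝓢(V, ℂ)) :
    repCLM V m (Heis.expCurve a b c s) Φ =
      (𝐞 ((m : ℝ) * (s * c - s ^ 2 * ⟪a, b⟫ / 2)) : ℂ) •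
        modCLM V (s • ((m : ℝ) • b)) (SchwartzMap.compSubConstCLM ℂ (s • a) Φ) := by
  rw [smul_comm s (m : ℝ) b]
  ext x
  rw [repCLM_apply, Heis.coe_expCurve_u_zpow, smul_apply, smul_eq_mul, modCLM_apply,
    SchwartzMap.compSubConstCLM_apply, Heis.expCurve_a, Heis.expCurve_b]

/-- (Ported verbatim from the HodgeCMPerL package; no docstring in the source.) -/
theorem tendsto_modCLM_smul_comp (b : V) {u : ℝ → 𝓢(V, ℂ)} {Ψ : 𝓢(V, ℂ)} {l : Filter ℝ}
    (hl : l ≤ 𝓝 0) (hu : Tendsto u l (𝓝 Ψ)) :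
    Tendsto (fun s : ℝ => modCLM V (s • b) (u s)) l (𝓝 Ψ) := by
  have hc : Tendsto (fun s : ℝ => s • b) l (𝓝 0) := by
    have h : Tendsto (fun s : ℝ => s • b) (𝓝 0) (𝓝 ((0 : ℝ) • b)) := tendsto_id.smul tendsto_const_nhds
    rw [zero_smul] at h
    exact h.mono_left hl
  have h := ((continuous_modCLM_uncurry V).tendsto (0, Ψ)).comp (hc.prodMk_nhds hu)
  simpa [Function.comp_def, modCLM_zero] using h

/-- **The infinitesimal Schrödinger representation.**  For every `a b : V`, `c : ℝ` and every Schwartz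
function `Φ`, in the Schwartz topology,
`s⁻¹ • (ρ_m(γ_{a,b,c}(s)) Φ - Φ) ⟶ -∂_{a} Φ + (2πi ⟪m b, ·⟫) Φ + (2πi m c) • Φ` as `s → 0`, `s ≠ 0`. -/
theorem tendsto_repCLM_expCurve_sub_div (a b : V) (c : ℝ) (Φ : 𝓢(V, ℂ)) :
    Tendsto (fun s : ℝ => s⁻¹ • (repCLM V m (Heis.expCurve a b c s) Φ - Φ)) (𝓝[≠] 0)
      (𝓝 (-∂_{a} Φ + SchwartzMap.smulLeftCLM ℂ (fun x : V => 2 * π * I * ((⟪(m : ℝ) • b, x⟫ : ℝ) : ℂ)) Φ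
        + (2 * π * I * ((m : ℝ) * c)) • Φ)) := by
  -- Step 1: translations.
  have hX := tendsto_compSubConstCLM_smul_sub_div V a Φ
  -- Step 2: modulation ∘ translation, via joint continuity of `(b, Φ) ↦ M_b Φ`.
  have hY : Tendsto (fun s : ℝ => s⁻¹ •
      (modCLM V (s • ((m : ℝ) • b)) (SchwartzMap.compSubConstCLM ℂ (s • a) Φ) - Φ)) (𝓝[≠] 0)
      (𝓝 (-∂_{a} Φ +
        SchwartzMap.smulLeftCLM ℂ (fun x : V => 2 * π * I * ((⟪(m : ℝ) • b, x⟫ : ℝ) : ℂ)) Φ)) := by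
    have h1 := tendsto_modCLM_smul_comp V ((m : ℝ) • b) nhdsWithin_le_nhds hX
    have h12 := h1.add (tendsto_modCLM_smul_sub_div V ((m : ℝ) • b) Φ)
    refine h12.congr' (Eventually.of_forall fun s => ?_)
    ext x
    simp only [add_apply, smul_apply, sub_apply, modCLM_apply, Complex.real_smul]
    ring
  -- Step 3: the scalar phase.
  have hZ := ((tendsto_fourierChar_phase (m : ℝ) c ⟪a, b⟫).smul hY).add
    ((tendsto_fourierChar_phase_sub_div (m : ℝ) c ⟪a, b⟫).smul_const Φ)
  rw [one_smul] at hZ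
  refine hZ.congr' (Eventually.of_forall fun s => ?_)
  dsimp only
  rw [repCLM_expCurve_apply]
  ext x
  simp only [add_apply, smul_apply, sub_apply, modCLM_apply, smul_eq_mul, Complex.real_smul]
  ring

/-- (Ported verbatim from the HodgeCMPerL package; no docstring in the source.) -/
theorem repCLM_expCurve_zero (a b : V) (c : ℝ) (Φ : 𝓢(V, ℂ)) : repCLM V m (Heis.expCurve a b c 0) Φ = Φ := by
  rw [Heis.expCurve_zero, repCLM_one, ContinuousLinearMap.id_apply]

/-- Vector-valued form: `s ↦ T (ρ_m(γ_{a,b,c}(s)) Φ)` is differentiable at `0` with the expected derivative, for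
every continuous `ℝ`-linear `T`. -/
theorem hasDerivAt_repCLM_expCurve {F : Type*} [NormedAddCommGroup F] [NormedSpace ℝ F] (a b : V) (c : ℝ)
    (Φ : 𝓢(V, ℂ)) (T : 𝓢(V, ℂ) →L[ℝ] F) :
    HasDerivAt (fun s : ℝ => T (repCLM V m (Heis.expCurve a b c s) Φ))
      (T (-∂_{a} Φ + SchwartzMap.smulLeftCLM ℂ (fun x : V => 2 * π * I * ((⟪(m : ℝ) • b, x⟫ : ℝ) : ℂ)) Φ
        + (2 * π * I * ((m : ℝ) * c)) • Φ)) 0 := by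
  rw [hasDerivAt_iff_tendsto_slope_zero]
  have h := (T.continuous.tendsto _).comp (tendsto_repCLM_expCurve_sub_div V m a b c Φ)
  refine h.congr' (Eventually.of_forall fun t => ?_)
  simp only [Function.comp_apply, zero_add, repCLM_expCurve_zero, map_smul, map_sub]

end SchwartzWeil
end HodgeCM
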